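import Summits.Ventures.QEC.Census.BB.A1s_n192_k16_7a9054e3.Distance
import Summits.Ventures.QEC.Census.TwoBGA.A1p_n192_k16_17efcc59.Distance
import Summits.Ventures.QEC.Census.TwoBGA.S8_7x14_w6_k18_000103.Distance
import Summits.Ventures.QEC.Census.BB.BBRows
import Summits.Ventures.QEC.Census.BB.Claims
import Literature.InformationTheory.QuantumCodes.TwoBlockConnectedComponents
import Literature.InformationTheory.QuantumCodes.TwoBlockToricLayout
import Literature.InformationTheory.QuantumCodes.TwoBlockWheelComponents
import Literature.InformationTheory.QuantumCodes.TwoBlockRootParameters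
import HarnessLib
import HarnessLib.Audit.Tags

/-!
# Census rows as TYPED two-block codes `QC(A, B)` on `ℤ_ℓ × ℤ_m` — bridge batch `DirRowsQC01` (3 row(s), kernel tier)

Family: abelian two-block over ℤ_ℓ × ℤ_m (qec census one-module KERNEL-std rows: qec-search-7 certificate modules, MITM and
Brouwer–Zimmermann/automorphism formats). For each census row below (an EXPLICIT matrix code
`cert.code _ = CSSCode.ofMatrices (rowMatrix n cert.HX) (rowMatrix n cert.HZ)` with `IsCode n k d` certified in its own module), this file
puts the row's CONSTRUCTION into the kernel statement, as in the pilot `Census/BB/A1s_n144_k32_4addf704QC.lean` (p511732) and the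
gen-4 batches `A1sRowsQC1–5` / `TwoBGARowsQC1–4`: monomial lists `la`, `lb` (from the certificate's construction record — the
docstring's `A_terms`/`B_terms` or the census row id `2bga-lℓmm-A…-B…`, monomials `xⁱyʲ` as `[i,j]`, convention of BCGMRY24 §4 =
`BivariateBicycleCodes.lean`; the index identity was ALSO re-verified row-for-row by the emitter before filing), the typed object
`qc : BB.Code ℓ m := ⟨polyL la, polyL lb⟩`, the kernel INDEX IDENTITIES `cert.HX = BBRows.rowsX la lb`, `cert.HZ = BBRows.rowsZ la lb`
(`decide`; verified row generator `Census/BB/BBRows.lean`, p502918), the flat identities via `BBRows.rowMatrix_rowsX/Z`, the transport of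
the row's own `dZ_eq` and `k` (its `k_eq`, or the `k`-component of its `isCode`) by type-05's `BB.Code.dZ_eq_of_flat` / `k_eq_of_flat` to
`qc_hasParams : BB.HasParams qc n k d` (census predicate of family BB, `Census/BB/Claims.lean`, distance EXACT) and
`qc_isCode : qc.css.IsCode n k d`; and the census LAYOUT columns (Bravyi et al. 2024 §4 — arXiv:2308.07915: Lemma 2 p0010 L49, Lemma 3 p0011 L9, Lemma 4 p0011 L28; locators per qec-ref-2 2026-08-27T10:27Z) as KERNEL verdicts: «connected» —
`qc_tannerGraph_connected` (Lemma 3, `BB.Code.tannerGraph_connected_of_unit_mem`, explicit multiples of exponent differences) or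
`qc_tannerGraph_not_connected` + `card_expDiffSubgroup` + `qc_card_connectedComponent` (`⟨S⟩` = an explicit finite carrier `diffList`,
both inclusions certified; exact component count by Lemma 3 (ii), `BB.Code.card_connectedComponent_mul_card`; by the tree's connected
normal form `TwoBlockConnectedComponents.lean` such a code is the disjoint union of that many copies of its root code, whose parameters
`[[n/c, k/c, d]]` and connectedness are certified here as `root_isCode` via `TwoBlockRootParameters.lean`); «toric layout» —
`qc_hasToricLayoutWith μ λ` (Lemma 4, `BB.Code.hasToricLayoutWith_of_exponents`; omitted when its sufficient condition has no witness);
«wheel layers» — `qc_wheel_layers` (Lemma 2 minus planarity, `BB.Code.exists_wheel_layers`, weight-(3,3) rows only):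

* `A1s_n192_k16_7a9054e3` = `QC(y^22 + y^23 + x, y^10 + y^20 + x^2)` on `ℤ_4 × ℤ_24`: `[[192, 16, 8]]`; Tanner graph connected; wheel layers 48/24
* `A1p_n192_k16_17efcc59` = `QC(1 + y + xy^2, 1 + y^2 + x^2y^16)` on `ℤ_4 × ℤ_24`: `[[192, 16, 8]]`; Tanner graph connected; wheel layers 48/24
* `S8_7x14_w6_k18_000103` = `QC(1 + y + y^3, 1 + x + x^3y^7)` on `ℤ_7 × ℤ_14`: `[[196, 18, 8]]`; Tanner graph connected; toric layout (14,7); wheel layers 14/14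

No new certificate — tier KERNEL, axioms standard, no `native_decide`. HONEST FRAMING: identifies already-certified census objects with
named algebraic constructions and decides structural (graph) properties; the census comparator columns (printed values, optimality
words) are not touched; for disconnected rows the root code is identified abstractly over `↥⟨S⟩` (not re-indexed to a named `QC(A',B')`,
not identified with a smaller census row); planarity/thickness is not asserted. Generated by
qec-type-05 gen 5's `tools/emit_qc_bridge2.py` + `tools/conn_cert.py` (HOME/lean/type-05/tools/).
-/

namespace Summit.Ventures.QEC.Census.A1s_n192_k16_7a9054e3

open Matrix Literature.InformationTheory.QuantumCodes BBRows

/-- Monomials of `A = y^22 + y^23 + x` (construction `A_terms = [[0, 22], [0, 23], [1, 0]]`, from the census generator file `census/search-3/gens/a1/A1s_n192_k16_7a9054e3.json` (matrix_sha256 `7a9054e3c9ff7a82…`; `A = y^22+y^23+x`, `B = y^10+y^20+x^2`)). DATA. -/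
def la : List (BB.Mono 4 24) := [(Fin.ofNat 4 0, Fin.ofNat 24 22), (Fin.ofNat 4 0, Fin.ofNat 24 23), (Fin.ofNat 4 1, Fin.ofNat 24 0)]

/-- Monomials of `B = y^10 + y^20 + x^2` (construction `B_terms = [[0, 10], [0, 20], [2, 0]]`). DATA. -/
def lb : List (BB.Mono 4 24) := [(Fin.ofNat 4 0, Fin.ofNat 24 10), (Fin.ofNat 4 0, Fin.ofNat 24 20), (Fin.ofNat 4 2, Fin.ofNat 24 0)]

/-- The census row's code as a TYPED two-block code `QC(y^22 + y^23 + x, y^10 + y^20 + x^2)` on `ℤ_4 × ℤ_24` (`BB.Code 4 24`). (definition) -/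
def qc : BB.Code 4 24 := ⟨polyL la, polyL lb⟩

set_option maxRecDepth 100000 in
/-- INDEX IDENTITY, `X` side, in the kernel: the certificate's `H^X` rows ARE the `X`-check words of `qc` (`decide +kernel`). -/
theorem HX_eq_rowsX : A1s_n192_k16_7a9054e3.cert.HX = rowsX la lb := by
  decide +kernel

set_option maxRecDepth 100000 in
/-- INDEX IDENTITY, `Z` side. -/
theorem HZ_eq_rowsZ : A1s_n192_k16_7a9054e3.cert.HZ = rowsZ la lb := by
  decide +kernel

set_option maxRecDepth 100000 in
/-- The certificate's flat `H^X` is `qc.HXFlat`. -/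
theorem rowMatrix_HX_eq : rowMatrix 192 A1s_n192_k16_7a9054e3.cert.HX = qc.HXFlat := by
  have cast : ∀ {H H' : List ℕ} (e : H = H'),
      rowMatrix 192 H = (rowMatrix 192 H').submatrix (Fin.cast (congrArg List.length e)) id := by
    intro H H' e; subst e; rfl
  exact (cast HX_eq_rowsX).trans (rowMatrix_rowsX qc (LA := la) (LB := lb) rfl rfl)

set_option maxRecDepth 100000 in
/-- The certificate's flat `H^Z` is `qc.HZFlat`. -/
theorem rowMatrix_HZ_eq : rowMatrix 192 A1s_n192_k16_7a9054e3.cert.HZ = qc.HZFlat := by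
  have cast : ∀ {H H' : List ℕ} (e : H = H'),
      rowMatrix 192 H = (rowMatrix 192 H').submatrix (Fin.cast (congrArg List.length e)) id := by
    intro H H' e; subst e; rfl
  exact (cast HZ_eq_rowsZ).trans (rowMatrix_rowsZ qc (LA := la) (LB := lb) rfl rfl)

set_option maxRecDepth 100000 in
/-- `d^Z (qc) = 8`, transported from the census certificate (`A1s_n192_k16_7a9054e3.dZ_eq`) by `BB.Code.dZ_eq_of_flat`. -/
theorem qc_dZ : qc.css.dZ = 8 :=
  (qc.dZ_eq_of_flat (D := A1s_n192_k16_7a9054e3.cert.code (A1s_n192_k16_7a9054e3.cert.commOK_of_checkStructure A1s_n192_k16_7a9054e3.checkStructure_ok))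
    rowMatrix_HX_eq rowMatrix_HZ_eq).symm.trans A1s_n192_k16_7a9054e3.dZ_eq

set_option maxRecDepth 100000 in
/-- `k (qc) = 16`, transported from the census certificate (`A1s_n192_k16_7a9054e3.k_eq`) by `BB.Code.k_eq_of_flat`. -/
theorem qc_k : qc.k = 16 :=
  (qc.k_eq_of_flat (D := A1s_n192_k16_7a9054e3.cert.code (A1s_n192_k16_7a9054e3.cert.commOK_of_checkStructure A1s_n192_k16_7a9054e3.checkStructure_ok))
    rowMatrix_HX_eq rowMatrix_HZ_eq).symm.trans A1s_n192_k16_7a9054e3.k_eq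

/-- **`QC(y^22 + y^23 + x, y^10 + y^20 + x^2)` on `ℤ_4 × ℤ_24` has parameters `[[192, 16, 8]]`** (distance exact; `BB.HasParams`) — the census row
`A1s_n192_k16_7a9054e3` read as a statement about the construction. KERNEL. -/
theorem qc_hasParams : Summit.Ventures.QEC.BB.HasParams qc 192 16 8 :=
  BB.hasParams_of_dZ (by simp only [BB.numQubits_eq]) qc_k qc_dZ

/-- The same in the generic census vocabulary: `qc.css.IsCode 192 16 8`. -/
theorem qc_isCode : qc.css.IsCode 192 16 8 :=
  (BB.hasParams_iff_isCode (by decide)).1 qc_hasParams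

set_option maxRecDepth 100000 in
/-- **The Tanner graph of `qc` is connected** (Bravyi et al. 2024 Lemma 3 / `BB.Code.tannerGraph_connected_of_unit_mem`): `x = (1,0)`
and `y = (0,1)` are explicit combinations of exponent differences inside `A` or inside `B` (found by qec-type-05's tools/conn_cert.py,
re-checked by `decide`). Census column «connected» for this row, KERNEL. -/
theorem qc_tannerGraph_connected : qc.css.tannerGraph.Connected := by
  refine qc.tannerGraph_connected_of_unit_mem (fun h => absurd (congrFun h ((0 : Fin 4), (22 : Fin 24))) (by decide))
    (fun h => absurd (congrFun h ((0 : Fin 4), (10 : Fin 24))) (by decide)) ?_ ?_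
  · have e : (((1 : Fin 4), (0 : Fin 24)) : BB.Mono 4 24) = (2 : ℕ) • ((((0 : Fin 4), (22 : Fin 24))) - (0, 23)) + (11 : ℕ) • ((((0 : Fin 4), (22 : Fin 24))) - (1, 0)) := by decide
    rw [e]
    exact (AddSubgroup.add_mem _ (AddSubgroup.nsmul_mem _ (qc.sub_mem_expDiffSubgroup_A (by decide) (by decide)) 2) (AddSubgroup.nsmul_mem _ (qc.sub_mem_expDiffSubgroup_A (by decide) (by decide)) 11))
  · have e : (((0 : Fin 4), (1 : Fin 24)) : BB.Mono 4 24) = (23 : ℕ) • ((((0 : Fin 4), (22 : Fin 24))) - (0, 23)) := by decide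
    rw [e]
    exact (AddSubgroup.nsmul_mem _ (qc.sub_mem_expDiffSubgroup_A (by decide) (by decide)) 23)

set_option maxRecDepth 100000 in
/-- **`qc`**: Tanner graph = edge-disjoint union of two layers whose components are wheel graphs `prismGraph 48` (`A₃A₂ᵀ` of order
`24`) and `prismGraph 24` (`B₂B₁ᵀ` of order `12`) — BCGMRY24 Lemma 2 minus planarity (`BB.Code.exists_wheel_layers`). KERNEL. -/
theorem qc_wheel_layers :
    ∃ ΓA ΓB : SimpleGraph ((BB.Mono 4 24 ⊕ BB.Mono 4 24) ⊕ (BB.Mono 4 24 ⊕ BB.Mono 4 24)),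
    qc.css.tannerGraph = ΓA ⊔ ΓB ∧ Disjoint ΓA ΓB ∧
    (∀ K : ΓA.ConnectedComponent, Nonempty (K.toSimpleGraph ≃g prismGraph 48)) ∧
    (∀ K : ΓB.ConnectedComponent, Nonempty (K.toSimpleGraph ≃g prismGraph 24)) := by
  have hA : ∀ g : BB.Mono 4 24, qc.A g ≠ 0 ↔ g = ((0 : Fin 4), (22 : Fin 24)) ∨ g = ((0 : Fin 4), (23 : Fin 24)) ∨ g = ((1 : Fin 4), (0 : Fin 24)) := by decide +kernel
  have hB : ∀ g : BB.Mono 4 24, qc.B g ≠ 0 ↔ g = ((0 : Fin 4), (10 : Fin 24)) ∨ g = ((0 : Fin 4), (20 : Fin 24)) ∨ g = ((2 : Fin 4), (0 : Fin 24)) := by decide +kernel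
  have h := qc.exists_wheel_layers (g₁ := ((0 : Fin 4), (22 : Fin 24))) (g₂ := ((0 : Fin 4), (23 : Fin 24))) (g₃ := ((1 : Fin 4), (0 : Fin 24))) (h₁ := ((0 : Fin 4), (10 : Fin 24)))
    (h₂ := ((0 : Fin 4), (20 : Fin 24))) (h₃ := ((2 : Fin 4), (0 : Fin 24))) (by decide) (by decide) (by decide) (by decide) (by decide) (by decide) hA hB
  have e1 : addOrderOf (((1 : Fin 4), (0 : Fin 24)) - (0, 23)) = 24 := (addOrderOf_eq_iff (by norm_num)).mpr (by decide)
  have e2 : addOrderOf (((0 : Fin 4), (20 : Fin 24)) - (0, 10)) = 12 := (addOrderOf_eq_iff (by norm_num)).mpr (by decide)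
  rw [e1, e2] at h
  exact h

end Summit.Ventures.QEC.Census.A1s_n192_k16_7a9054e3

namespace Summit.Ventures.QEC.Census.A1p_n192_k16_17efcc59

open Matrix Literature.InformationTheory.QuantumCodes BBRows

/-- Monomials of `A = 1 + y + xy^2` (construction `A_terms = [[0, 0], [0, 1], [1, 2]]`, from the census generator file `census/search-3/gens/a1plus/A1p_n192_k16_17efcc59.json` (matrix_sha256 `17efcc5903caccf7…`; `A = 1+y+x*y^2`, `B = 1+y^2+x^2*y^16`)). DATA. -/
def la : List (BB.Mono 4 24) := [(Fin.ofNat 4 0, Fin.ofNat 24 0), (Fin.ofNat 4 0, Fin.ofNat 24 1), (Fin.ofNat 4 1, Fin.ofNat 24 2)]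

/-- Monomials of `B = 1 + y^2 + x^2y^16` (construction `B_terms = [[0, 0], [0, 2], [2, 16]]`). DATA. -/
def lb : List (BB.Mono 4 24) := [(Fin.ofNat 4 0, Fin.ofNat 24 0), (Fin.ofNat 4 0, Fin.ofNat 24 2), (Fin.ofNat 4 2, Fin.ofNat 24 16)]

/-- The census row's code as a TYPED two-block code `QC(1 + y + xy^2, 1 + y^2 + x^2y^16)` on `ℤ_4 × ℤ_24` (`BB.Code 4 24`). (definition) -/
def qc : BB.Code 4 24 := ⟨polyL la, polyL lb⟩

set_option maxRecDepth 100000 in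
/-- INDEX IDENTITY, `X` side, in the kernel: the certificate's `H^X` rows ARE the `X`-check words of `qc` (`decide +kernel`). -/
theorem HX_eq_rowsX : A1p_n192_k16_17efcc59.cert.HX = rowsX la lb := by
  decide +kernel

set_option maxRecDepth 100000 in
/-- INDEX IDENTITY, `Z` side. -/
theorem HZ_eq_rowsZ : A1p_n192_k16_17efcc59.cert.HZ = rowsZ la lb := by
  decide +kernel

set_option maxRecDepth 100000 in
/-- The certificate's flat `H^X` is `qc.HXFlat`. -/
theorem rowMatrix_HX_eq : rowMatrix 192 A1p_n192_k16_17efcc59.cert.HX = qc.HXFlat := by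
  have cast : ∀ {H H' : List ℕ} (e : H = H'),
      rowMatrix 192 H = (rowMatrix 192 H').submatrix (Fin.cast (congrArg List.length e)) id := by
    intro H H' e; subst e; rfl
  exact (cast HX_eq_rowsX).trans (rowMatrix_rowsX qc (LA := la) (LB := lb) rfl rfl)

set_option maxRecDepth 100000 in
/-- The certificate's flat `H^Z` is `qc.HZFlat`. -/
theorem rowMatrix_HZ_eq : rowMatrix 192 A1p_n192_k16_17efcc59.cert.HZ = qc.HZFlat := by
  have cast : ∀ {H H' : List ℕ} (e : H = H'),
      rowMatrix 192 H = (rowMatrix 192 H').submatrix (Fin.cast (congrArg List.length e)) id := by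
    intro H H' e; subst e; rfl
  exact (cast HZ_eq_rowsZ).trans (rowMatrix_rowsZ qc (LA := la) (LB := lb) rfl rfl)

set_option maxRecDepth 100000 in
/-- `d^Z (qc) = 8`, transported from the census certificate (`A1p_n192_k16_17efcc59.dZ_eq`) by `BB.Code.dZ_eq_of_flat`. -/
theorem qc_dZ : qc.css.dZ = 8 :=
  (qc.dZ_eq_of_flat (D := A1p_n192_k16_17efcc59.cert.code (A1p_n192_k16_17efcc59.cert.commOK_of_checkStructure A1p_n192_k16_17efcc59.checkStructure_ok))
    rowMatrix_HX_eq rowMatrix_HZ_eq).symm.trans A1p_n192_k16_17efcc59.dZ_eq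

set_option maxRecDepth 100000 in
/-- `k (qc) = 16`, transported from the census certificate (`A1p_n192_k16_17efcc59.k_eq`) by `BB.Code.k_eq_of_flat`. -/
theorem qc_k : qc.k = 16 :=
  (qc.k_eq_of_flat (D := A1p_n192_k16_17efcc59.cert.code (A1p_n192_k16_17efcc59.cert.commOK_of_checkStructure A1p_n192_k16_17efcc59.checkStructure_ok))
    rowMatrix_HX_eq rowMatrix_HZ_eq).symm.trans A1p_n192_k16_17efcc59.k_eq

/-- **`QC(1 + y + xy^2, 1 + y^2 + x^2y^16)` on `ℤ_4 × ℤ_24` has parameters `[[192, 16, 8]]`** (distance exact; `BB.HasParams`) — the census row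
`A1p_n192_k16_17efcc59` read as a statement about the construction. KERNEL. -/
theorem qc_hasParams : Summit.Ventures.QEC.BB.HasParams qc 192 16 8 :=
  BB.hasParams_of_dZ (by simp only [BB.numQubits_eq]) qc_k qc_dZ

/-- The same in the generic census vocabulary: `qc.css.IsCode 192 16 8`. -/
theorem qc_isCode : qc.css.IsCode 192 16 8 :=
  (BB.hasParams_iff_isCode (by decide)).1 qc_hasParams

set_option maxRecDepth 100000 in
/-- **The Tanner graph of `qc` is connected** (Bravyi et al. 2024 Lemma 3 / `BB.Code.tannerGraph_connected_of_unit_mem`): `x = (1,0)`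
and `y = (0,1)` are explicit combinations of exponent differences inside `A` or inside `B` (found by qec-type-05's tools/conn_cert.py,
re-checked by `decide`). Census column «connected» for this row, KERNEL. -/
theorem qc_tannerGraph_connected : qc.css.tannerGraph.Connected := by
  refine qc.tannerGraph_connected_of_unit_mem (fun h => absurd (congrFun h ((0 : Fin 4), (0 : Fin 24))) (by decide))
    (fun h => absurd (congrFun h ((0 : Fin 4), (0 : Fin 24))) (by decide)) ?_ ?_
  · have e : (((1 : Fin 4), (0 : Fin 24)) : BB.Mono 4 24) = (2 : ℕ) • ((((0 : Fin 4), (0 : Fin 24))) - (0, 1)) + (11 : ℕ) • ((((0 : Fin 4), (0 : Fin 24))) - (1, 2)) := by decide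
    rw [e]
    exact (AddSubgroup.add_mem _ (AddSubgroup.nsmul_mem _ (qc.sub_mem_expDiffSubgroup_A (by decide) (by decide)) 2) (AddSubgroup.nsmul_mem _ (qc.sub_mem_expDiffSubgroup_A (by decide) (by decide)) 11))
  · have e : (((0 : Fin 4), (1 : Fin 24)) : BB.Mono 4 24) = (23 : ℕ) • ((((0 : Fin 4), (0 : Fin 24))) - (0, 1)) := by decide
    rw [e]
    exact (AddSubgroup.nsmul_mem _ (qc.sub_mem_expDiffSubgroup_A (by decide) (by decide)) 23)

set_option maxRecDepth 100000 in
/-- **`qc`**: Tanner graph = edge-disjoint union of two layers whose components are wheel graphs `prismGraph 48` (`A₃A₂ᵀ` of order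
`24`) and `prismGraph 24` (`B₂B₁ᵀ` of order `12`) — BCGMRY24 Lemma 2 minus planarity (`BB.Code.exists_wheel_layers`). KERNEL. -/
theorem qc_wheel_layers :
    ∃ ΓA ΓB : SimpleGraph ((BB.Mono 4 24 ⊕ BB.Mono 4 24) ⊕ (BB.Mono 4 24 ⊕ BB.Mono 4 24)),
    qc.css.tannerGraph = ΓA ⊔ ΓB ∧ Disjoint ΓA ΓB ∧
    (∀ K : ΓA.ConnectedComponent, Nonempty (K.toSimpleGraph ≃g prismGraph 48)) ∧
    (∀ K : ΓB.ConnectedComponent, Nonempty (K.toSimpleGraph ≃g prismGraph 24)) := by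
  have hA : ∀ g : BB.Mono 4 24, qc.A g ≠ 0 ↔ g = ((0 : Fin 4), (0 : Fin 24)) ∨ g = ((0 : Fin 4), (1 : Fin 24)) ∨ g = ((1 : Fin 4), (2 : Fin 24)) := by decide +kernel
  have hB : ∀ g : BB.Mono 4 24, qc.B g ≠ 0 ↔ g = ((0 : Fin 4), (0 : Fin 24)) ∨ g = ((0 : Fin 4), (2 : Fin 24)) ∨ g = ((2 : Fin 4), (16 : Fin 24)) := by decide +kernel
  have h := qc.exists_wheel_layers (g₁ := ((0 : Fin 4), (0 : Fin 24))) (g₂ := ((0 : Fin 4), (1 : Fin 24))) (g₃ := ((1 : Fin 4), (2 : Fin 24))) (h₁ := ((0 : Fin 4), (0 : Fin 24)))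
    (h₂ := ((0 : Fin 4), (2 : Fin 24))) (h₃ := ((2 : Fin 4), (16 : Fin 24))) (by decide) (by decide) (by decide) (by decide) (by decide) (by decide) hA hB
  have e1 : addOrderOf (((1 : Fin 4), (2 : Fin 24)) - (0, 1)) = 24 := (addOrderOf_eq_iff (by norm_num)).mpr (by decide)
  have e2 : addOrderOf (((0 : Fin 4), (2 : Fin 24)) - (0, 0)) = 12 := (addOrderOf_eq_iff (by norm_num)).mpr (by decide)
  rw [e1, e2] at h
  exact h

end Summit.Ventures.QEC.Census.A1p_n192_k16_17efcc59

namespace Summit.Ventures.QEC.Census.S8_7x14_w6_k18_000103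

open Matrix Literature.InformationTheory.QuantumCodes BBRows

/-- Monomials of `A = 1 + y + y^3` (construction `A_terms = [[0, 0], [0, 1], [0, 3]]`, from the census generator file `census/search-3/gens/a1plus/A1p_n196_k18_48376be1.json` (matrix_sha256 `48376be126f8d278…`; `A = 1+y+y^3`, `B = 1+x+x^3*y^7`)). DATA. -/
def la : List (BB.Mono 7 14) := [(Fin.ofNat 7 0, Fin.ofNat 14 0), (Fin.ofNat 7 0, Fin.ofNat 14 1), (Fin.ofNat 7 0, Fin.ofNat 14 3)]

/-- Monomials of `B = 1 + x + x^3y^7` (construction `B_terms = [[0, 0], [1, 0], [3, 7]]`). DATA. -/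
def lb : List (BB.Mono 7 14) := [(Fin.ofNat 7 0, Fin.ofNat 14 0), (Fin.ofNat 7 1, Fin.ofNat 14 0), (Fin.ofNat 7 3, Fin.ofNat 14 7)]

/-- The census row's code as a TYPED two-block code `QC(1 + y + y^3, 1 + x + x^3y^7)` on `ℤ_7 × ℤ_14` (`BB.Code 7 14`). (definition) -/
def qc : BB.Code 7 14 := ⟨polyL la, polyL lb⟩

set_option maxRecDepth 100000 in
/-- INDEX IDENTITY, `X` side, in the kernel: the certificate's `H^X` rows ARE the `X`-check words of `qc` (`decide +kernel`). -/
theorem HX_eq_rowsX : S8_7x14_w6_k18_000103.cert.HX = rowsX la lb := by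
  decide +kernel

set_option maxRecDepth 100000 in
/-- INDEX IDENTITY, `Z` side. -/
theorem HZ_eq_rowsZ : S8_7x14_w6_k18_000103.cert.HZ = rowsZ la lb := by
  decide +kernel

set_option maxRecDepth 100000 in
/-- The certificate's flat `H^X` is `qc.HXFlat`. -/
theorem rowMatrix_HX_eq : rowMatrix 196 S8_7x14_w6_k18_000103.cert.HX = qc.HXFlat := by
  have cast : ∀ {H H' : List ℕ} (e : H = H'),
      rowMatrix 196 H = (rowMatrix 196 H').submatrix (Fin.cast (congrArg List.length e)) id := by
    intro H H' e; subst e; rfl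
  exact (cast HX_eq_rowsX).trans (rowMatrix_rowsX qc (LA := la) (LB := lb) rfl rfl)

set_option maxRecDepth 100000 in
/-- The certificate's flat `H^Z` is `qc.HZFlat`. -/
theorem rowMatrix_HZ_eq : rowMatrix 196 S8_7x14_w6_k18_000103.cert.HZ = qc.HZFlat := by
  have cast : ∀ {H H' : List ℕ} (e : H = H'),
      rowMatrix 196 H = (rowMatrix 196 H').submatrix (Fin.cast (congrArg List.length e)) id := by
    intro H H' e; subst e; rfl
  exact (cast HZ_eq_rowsZ).trans (rowMatrix_rowsZ qc (LA := la) (LB := lb) rfl rfl)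

set_option maxRecDepth 100000 in
/-- `d^Z (qc) = 8`, transported from the census certificate (`S8_7x14_w6_k18_000103.dZ_eq`) by `BB.Code.dZ_eq_of_flat`. -/
theorem qc_dZ : qc.css.dZ = 8 :=
  (qc.dZ_eq_of_flat (D := S8_7x14_w6_k18_000103.cert.code (S8_7x14_w6_k18_000103.cert.commOK_of_checkStructure S8_7x14_w6_k18_000103.checkStructure_ok))
    rowMatrix_HX_eq rowMatrix_HZ_eq).symm.trans S8_7x14_w6_k18_000103.dZ_eq

set_option maxRecDepth 100000 in
/-- `k (qc) = 18`, transported from the census certificate (`S8_7x14_w6_k18_000103.k_eq`) by `BB.Code.k_eq_of_flat`. -/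
theorem qc_k : qc.k = 18 :=
  (qc.k_eq_of_flat (D := S8_7x14_w6_k18_000103.cert.code (S8_7x14_w6_k18_000103.cert.commOK_of_checkStructure S8_7x14_w6_k18_000103.checkStructure_ok))
    rowMatrix_HX_eq rowMatrix_HZ_eq).symm.trans S8_7x14_w6_k18_000103.k_eq

/-- **`QC(1 + y + y^3, 1 + x + x^3y^7)` on `ℤ_7 × ℤ_14` has parameters `[[196, 18, 8]]`** (distance exact; `BB.HasParams`) — the census row
`S8_7x14_w6_k18_000103` read as a statement about the construction. KERNEL. -/
theorem qc_hasParams : Summit.Ventures.QEC.BB.HasParams qc 196 18 8 :=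
  BB.hasParams_of_dZ (by simp only [BB.numQubits_eq]) qc_k qc_dZ

/-- The same in the generic census vocabulary: `qc.css.IsCode 196 18 8`. -/
theorem qc_isCode : qc.css.IsCode 196 18 8 :=
  (BB.hasParams_iff_isCode (by decide)).1 qc_hasParams

set_option maxRecDepth 100000 in
/-- **The Tanner graph of `qc` is connected** (Bravyi et al. 2024 Lemma 3 / `BB.Code.tannerGraph_connected_of_unit_mem`): `x = (1,0)`
and `y = (0,1)` are explicit combinations of exponent differences inside `A` or inside `B` (found by qec-type-05's tools/conn_cert.py,
re-checked by `decide`). Census column «connected» for this row, KERNEL. -/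
theorem qc_tannerGraph_connected : qc.css.tannerGraph.Connected := by
  refine qc.tannerGraph_connected_of_unit_mem (fun h => absurd (congrFun h ((0 : Fin 7), (0 : Fin 14))) (by decide))
    (fun h => absurd (congrFun h ((0 : Fin 7), (0 : Fin 14))) (by decide)) ?_ ?_
  · have e : (((1 : Fin 7), (0 : Fin 14)) : BB.Mono 7 14) = (6 : ℕ) • ((((0 : Fin 7), (0 : Fin 14))) - (1, 0)) := by decide
    rw [e]
    exact (AddSubgroup.nsmul_mem _ (qc.sub_mem_expDiffSubgroup_B (by decide) (by decide)) 6)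
  · have e : (((0 : Fin 7), (1 : Fin 14)) : BB.Mono 7 14) = (13 : ℕ) • ((((0 : Fin 7), (0 : Fin 14))) - (0, 1)) := by decide
    rw [e]
    exact (AddSubgroup.nsmul_mem _ (qc.sub_mem_expDiffSubgroup_A (by decide) (by decide)) 13)

/-- The two layout generators `A_iA_jᵀ ↦ (0, 0) − (0, 1)` and `B_gB_hᵀ ↦ (0, 0) − (1, 0)` generate `ℤ_7 × ℤ_14`
(explicit multiples giving `x` and `y`, `decide`d). -/
theorem qc_layout_closure_eq_top : AddSubgroup.closure ({((0 : Fin 7), (0 : Fin 14)) - (0, 1), ((0 : Fin 7), (0 : Fin 14)) - (1, 0)} : Set (BB.Mono 7 14)) = ⊤ := by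
  apply BB.Code.addSubgroup_eq_top_of_unit_mem
  · have h1 := AddSubgroup.subset_closure (k := ({((0 : Fin 7), (0 : Fin 14)) - (0, 1), ((0 : Fin 7), (0 : Fin 14)) - (1, 0)} : Set (BB.Mono 7 14))) (Set.mem_insert _ _)
    have h2 := AddSubgroup.subset_closure (k := ({((0 : Fin 7), (0 : Fin 14)) - (0, 1), ((0 : Fin 7), (0 : Fin 14)) - (1, 0)} : Set (BB.Mono 7 14))) (Set.mem_insert_of_mem _ rfl)
    have e : (0 : ℕ) • (((0 : Fin 7), (0 : Fin 14)) - (0, 1)) + (6 : ℕ) • (((0 : Fin 7), (0 : Fin 14)) - (1, 0)) = (1, 0) := by decide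
    have h' := AddSubgroup.add_mem _ (AddSubgroup.nsmul_mem _ h1 0) (AddSubgroup.nsmul_mem _ h2 6)
    rw [e] at h'
    exact h'
  · have h1 := AddSubgroup.subset_closure (k := ({((0 : Fin 7), (0 : Fin 14)) - (0, 1), ((0 : Fin 7), (0 : Fin 14)) - (1, 0)} : Set (BB.Mono 7 14))) (Set.mem_insert _ _)
    have h2 := AddSubgroup.subset_closure (k := ({((0 : Fin 7), (0 : Fin 14)) - (0, 1), ((0 : Fin 7), (0 : Fin 14)) - (1, 0)} : Set (BB.Mono 7 14))) (Set.mem_insert_of_mem _ rfl)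
    have e : (13 : ℕ) • (((0 : Fin 7), (0 : Fin 14)) - (0, 1)) + (0 : ℕ) • (((0 : Fin 7), (0 : Fin 14)) - (1, 0)) = (0, 1) := by decide
    have h' := AddSubgroup.add_mem _ (AddSubgroup.nsmul_mem _ h1 13) (AddSubgroup.nsmul_mem _ h2 0)
    rw [e] at h'
    exact h'

set_option maxRecDepth 100000 in
/-- Orders of the two layout generators: `14` and `7` (product `98 = ℓm`). -/
theorem qc_layout_orders : addOrderOf (((0 : Fin 7), (0 : Fin 14)) - (0, 1)) = 14 ∧ addOrderOf (((0 : Fin 7), (0 : Fin 14)) - (1, 0)) = 7 :=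
  ⟨(addOrderOf_eq_iff (by norm_num)).mpr (by decide), (addOrderOf_eq_iff (by norm_num)).mpr (by decide)⟩

/-- **`qc` has a toric layout with `(μ, λ) = (14, 7)`** (Bravyi et al. 2024 Lemma 4 / `BB.Code.hasToricLayoutWith_of_exponents`):
census layout column, KERNEL. -/
theorem qc_hasToricLayoutWith : HasToricLayoutWith 14 7 qc.css.tannerGraph := by
  have h := qc.hasToricLayoutWith_of_exponents (g := ((0 : Fin 7), (0 : Fin 14))) (g' := (0, 1))
    (h := ((0 : Fin 7), (0 : Fin 14))) (h' := (1, 0)) (by decide) (by decide) (by decide) (by decide)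
    qc_layout_closure_eq_top (by rw [qc_layout_orders.1, qc_layout_orders.2])
  rwa [qc_layout_orders.1, qc_layout_orders.2] at h

/-- `qc` has a toric layout. KERNEL. -/
theorem qc_hasToricLayout : HasToricLayout qc.css.tannerGraph :=
  ⟨14, 7, by norm_num, by norm_num, qc_hasToricLayoutWith⟩

set_option maxRecDepth 100000 in
/-- **`qc`**: Tanner graph = edge-disjoint union of two layers whose components are wheel graphs `prismGraph 14` (`A₃A₂ᵀ` of order
`7`) and `prismGraph 14` (`B₂B₁ᵀ` of order `7`) — BCGMRY24 Lemma 2 minus planarity (`BB.Code.exists_wheel_layers`). KERNEL. -/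
theorem qc_wheel_layers :
    ∃ ΓA ΓB : SimpleGraph ((BB.Mono 7 14 ⊕ BB.Mono 7 14) ⊕ (BB.Mono 7 14 ⊕ BB.Mono 7 14)),
    qc.css.tannerGraph = ΓA ⊔ ΓB ∧ Disjoint ΓA ΓB ∧
    (∀ K : ΓA.ConnectedComponent, Nonempty (K.toSimpleGraph ≃g prismGraph 14)) ∧
    (∀ K : ΓB.ConnectedComponent, Nonempty (K.toSimpleGraph ≃g prismGraph 14)) := by
  have hA : ∀ g : BB.Mono 7 14, qc.A g ≠ 0 ↔ g = ((0 : Fin 7), (0 : Fin 14)) ∨ g = ((0 : Fin 7), (1 : Fin 14)) ∨ g = ((0 : Fin 7), (3 : Fin 14)) := by decide +kernel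
  have hB : ∀ g : BB.Mono 7 14, qc.B g ≠ 0 ↔ g = ((0 : Fin 7), (0 : Fin 14)) ∨ g = ((1 : Fin 7), (0 : Fin 14)) ∨ g = ((3 : Fin 7), (7 : Fin 14)) := by decide +kernel
  have h := qc.exists_wheel_layers (g₁ := ((0 : Fin 7), (0 : Fin 14))) (g₂ := ((0 : Fin 7), (1 : Fin 14))) (g₃ := ((0 : Fin 7), (3 : Fin 14))) (h₁ := ((0 : Fin 7), (0 : Fin 14)))
    (h₂ := ((1 : Fin 7), (0 : Fin 14))) (h₃ := ((3 : Fin 7), (7 : Fin 14))) (by decide) (by decide) (by decide) (by decide) (by decide) (by decide) hA hB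
  have e1 : addOrderOf (((0 : Fin 7), (3 : Fin 14)) - (0, 1)) = 7 := (addOrderOf_eq_iff (by norm_num)).mpr (by decide)
  have e2 : addOrderOf (((1 : Fin 7), (0 : Fin 14)) - (0, 0)) = 7 := (addOrderOf_eq_iff (by norm_num)).mpr (by decide)
  rw [e1, e2] at h
  exact h

end Summit.Ventures.QEC.Census.S8_7x14_w6_k18_000103
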